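import Literature.Probability.Percolation.PlateChartRoom
import Literature.Probability.Percolation.FullPlaneCNL
import Literature.Probability.Percolation.MedialLoopStretch
import Literature.Topology.PlaneTopology.PlusCrossing
import HarnessLib

/-!
# A vertical honeycomb loop arc, close to the `ℤ²` loops, blocks the monochromatic horizontal `ℤ²` plate crossings

Topic: Probability / Percolation; proofs only.  The deterministic `ℤ²` half of the transfer of
crossing events between two percolation models whose typed loop configurations are close in the
sense of Duminil-Copin–Kozlowski–Krachun–Manolescu–Oulamara (arXiv:2012.11672v2, §1.2:
`LoopConfig.IsClose η`, every loop in the window `B(0, 1/η)` has a partner of the same type at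
loop distance `d ≤ η`), following Camia–Newman (Comm. Math. Phys. 268 (2006), §5: crossings are
read off arcs of the interface loops, and arcs of close loops follow each other), in the plate
vocabulary of `PlateCrossingEvents.lean` (chart `Φ : ℂ ≃ₜ ℂ`, `plateBox`, `zdPlateH`,
`zdMonoPlateH`, `dualDraw`):

* `not_mem_zdPlateH_meshPoint_of_chart_vertical`, `not_mem_zdPlateH_dualDraw_of_chart_vertical` —
  **plus-position blocking**: a compact connected `V` whose chart pull-back lies in the strip
  `|re| ≤ a` and meets `{im ≤ -d}` and `{d ≤ im}` excludes every primal (resp. dual) horizontal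
  plate crossing `zdPlateH _ Φ xin xout y` with `a ≤ xin`, `y + ν ≤ d` whose drawn trace would
  have to miss `V` (`inter_nonempty_of_plus_chart`; Bollobás–Riordan, *Percolation* (2006), Ch. 7
  Claim 19: a horizontal and a vertical crossing meet);
* `not_mem_zdMonoPlateH_of_closeArc` — **the blocking theorem**: if the bond configuration
  `ω ⊆ E(ℤ²)` and the site configuration `ω'` of `𝕋` have `η`-close typed loop configurations
  (`bondLoopConfig δ 0 ω`, `siteLoopConfig δ ω'`), and a honeycomb interface loop `w` of `ω'` with
  trace in `B(0, 1/η)` has a based representative `β` with a parameter interval `[s, t]` mapped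
  into `Φ(plateBox (x + c/2) yin)` and meeting `Φ{im ≤ -(yin - c/2)}` and `Φ{yin - c/2 ≤ im}`,
  then `ω` has no primal and no dual horizontal crossing of the plate `Φ(plateBox xout (yin - c))`
  between `Φ{re ≤ -(x + c)}` and `Φ{x + c ≤ re}` (`η ≤ η₀(Φ, c)`, `δ ≤ δ₀(Φ, c)`).  Proof: the
  partner medial loop `γ` of `ω` (`IsClose`, `mem_bondLoopConfig_iff`) carries a stretch of darts
  pointwise `2η`-close to `β([s, t])` (`IsInterfaceLoop.exists_dart_stretch_of_udist_lt`); its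
  left vertices form an open walk and its right faces a dual-open walk
  (`exists_left_walk_iterate`, `exists_cFace_walk_iterate`), both vertical in the chart with room
  (`exists_chart_room_symm'`); a primal horizontal crossing would meet the dual walk and a dual one
  the open walk, but open traces miss dual-open dual traces
  (`disjoint_meshTrace_image_dualScale_walkTrace`).

## References

* F. Camia, C. M. Newman, Comm. Math. Phys. 268 (2006), §5. [CamiaNewman2006]
* H. Duminil-Copin et al., arXiv:2012.11672v2 (2026), §1.2 and §5.2. [arXiv201211672v2]
* B. Bollobás, O. Riordan, *Percolation*, CUP (2006), Ch. 7, Claim 19 p. 192. [BollobasRiordan2006]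
-/

noncomputable section

namespace Literature.Probability.Percolation

open Literature.Probability.RandomPlanarGeometry
open Literature.Probability.LatticeModels
open Literature.Topology.PlaneTopology
open Filter Topology Set Metric Complex Function
open scoped unitInterval

/-! ### Plus-position blocking of horizontal plate crossings by a chart-vertical continuum -/

/-- **A chart-vertical continuum off the open traces blocks the primal horizontal plate
crossings.**  With chart room `(ν, ρ)` and `0 < δ ≤ ρ`: if `V` is compact and connected, pulls
back into the strip `|re| ≤ a ≤ xin` and meets `{im ≤ -d}` and `{d ≤ im}` with `y + ν ≤ d`, and
the mesh trace of every `ω`-open walk misses `V`, then `ω ∉ zdPlateH (meshPoint δ) Φ xin xout y`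
(an open plate path pulls back into the band `|im| ≤ y + ν` and joins `{re ≤ -xin}` to
`{xin ≤ re}`, so it meets `V`). [cite: BollobasRiordan2006, Ch. 7 Claim 19 p. 192] -/
theorem not_mem_zdPlateH_meshPoint_of_chart_vertical (Φ : ℂ ≃ₜ ℂ) {ν ρ δ : ℝ}
    (hroom : ∀ z ∈ plateBox 2 2, ∀ p : ℂ, dist p (Φ z) ≤ ρ → dist (Φ.symm p) z ≤ ν)
    (hδ : 0 < δ) (hδρ : δ ≤ ρ) {xin xout y a d : ℝ} (hxin : 0 < xin) (ha : 0 ≤ a) (haxin : a ≤ xin)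
    (hd : y + ν ≤ d) (hd0 : 0 ≤ d) (hxout : xout ≤ 2) (hy : y ≤ 2)
    {V : Set ℂ} (hVc : IsCompact V) (hVp : IsPreconnected V)
    (hVstrip : ∀ p ∈ V, |(Φ.symm p).re| ≤ a) (hVbot : ∃ p ∈ V, (Φ.symm p).im ≤ -d)
    (hVtop : ∃ p ∈ V, d ≤ (Φ.symm p).im) {ω : BondConfig (Site 2)} (hωE : ω ⊆ (zdGraph 2).edgeSet)
    (hdisj : ∀ {u v : Site 2} (P : (zdGraph 2).Walk u v), (∀ e ∈ P.edges, e ∈ ω) → Disjoint (meshTrace δ P) V) :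
    ω ∉ zdPlateH (meshPoint δ) Φ xin xout y := by
  rw [zdPlateH, mem_openCrossing_iff]
  rintro ⟨uP, huP, vP, hvP, hconn⟩
  obtain ⟨P, hPS, hPω⟩ := exists_walk_of_mem_openConnIn hωE hconn
  have huP' : (Φ.symm (meshPoint δ uP)).re ≤ -xin := symm_mem_of_mem_image huP
  have hvP' : xin ≤ (Φ.symm (meshPoint δ vP)).re := symm_mem_of_mem_image hvP
  have hne : uP ≠ vP := by intro h; rw [h] at huP'; linarith
  have hPnil : ¬ P.Nil := SimpleGraph.Walk.not_nil_of_ne hne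
  obtain ⟨pt, hptV, hptH⟩ := inter_nonempty_of_plus_chart Φ (V := V) (H := meshTrace δ P)
    (a := -a) (b := a) (c := -d) (d := d) (by linarith) (by linarith) hVc hVp
    (fun p hp ↦ abs_le.1 (hVstrip p hp))
    (by obtain ⟨p, hp, h⟩ := hVbot; exact ⟨p, hp, h⟩) hVtop
    (isCompact_meshTrace δ P) (isPreconnected_meshTrace δ P)
    (fun p hp ↦ by
      have h := symm_meshTrace_subset hδ hδρ hroom hxout hy hPS hp
      rw [mem_plateBox_iff_abs] at h
      exact abs_le.1 (h.2.trans hd))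
    ⟨_, meshPoint_mem_meshTrace_of_mem_support hPnil P.start_mem_support, by linarith⟩
    ⟨_, meshPoint_mem_meshTrace_of_mem_support hPnil P.end_mem_support, by linarith⟩
  exact Set.disjoint_left.1 (hdisj P hPω) hptH hptV

/-- **A chart-vertical continuum off the dual-open dual traces blocks the dual horizontal plate
crossings** (faces drawn by `dualDraw δ`; the planar dual trace `dualScale δ '' walkTrace` of
every dual-open walk misses `V`). [cite: BollobasRiordan2006, Ch. 7 Claim 19 p. 192] -/
theorem not_mem_zdPlateH_dualDraw_of_chart_vertical (Φ : ℂ ≃ₜ ℂ) {ν ρ δ : ℝ}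
    (hroom : ∀ z ∈ plateBox 2 2, ∀ p : ℂ, dist p (Φ z) ≤ ρ → dist (Φ.symm p) z ≤ ν)
    (hδ : 0 < δ) (hδρ : δ ≤ ρ) {xin xout y a d : ℝ} (hxin : 0 < xin) (ha : 0 ≤ a) (haxin : a ≤ xin)
    (hd : y + ν ≤ d) (hd0 : 0 ≤ d) (hxout : xout ≤ 2) (hy : y ≤ 2)
    {V : Set ℂ} (hVc : IsCompact V) (hVp : IsPreconnected V)
    (hVstrip : ∀ p ∈ V, |(Φ.symm p).re| ≤ a) (hVbot : ∃ p ∈ V, (Φ.symm p).im ≤ -d)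
    (hVtop : ∃ p ∈ V, d ≤ (Φ.symm p).im) {ω : BondConfig (Site 2)}
    (hdisj : ∀ {u v : Site 2} (D : (zdGraph 2).Walk u v), (∀ e ∈ D.edges, e ∈ dualConfig ω) →
      Disjoint (dualScale δ '' walkTrace D) V) :
    dualConfig ω ∉ zdPlateH (dualDraw δ) Φ xin xout y := by
  rw [zdPlateH, mem_openCrossing_iff]
  rintro ⟨fD, hfD, gD, hgD, hconn⟩
  obtain ⟨D, hDS, hDω⟩ := exists_walk_of_mem_openConnIn (fun _ h ↦ h.1 : dualConfig ω ⊆ (zdGraph 2).edgeSet) hconn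
  have hfD' : (Φ.symm (dualDraw δ fD)).re ≤ -xin := symm_mem_of_mem_image hfD
  have hgD' : xin ≤ (Φ.symm (dualDraw δ gD)).re := symm_mem_of_mem_image hgD
  have hne : fD ≠ gD := by intro h; rw [h] at hfD'; linarith
  have hDnil : ¬ D.Nil := SimpleGraph.Walk.not_nil_of_ne hne
  have hdc : Continuous (dualScale δ) := continuous_dualScale δ
  obtain ⟨pt, hptV, hptH⟩ := inter_nonempty_of_plus_chart Φ (V := V) (H := dualScale δ '' walkTrace D)
    (a := -a) (b := a) (c := -d) (d := d) (by linarith) (by linarith) hVc hVp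
    (fun p hp ↦ abs_le.1 (hVstrip p hp))
    (by obtain ⟨p, hp, h⟩ := hVbot; exact ⟨p, hp, h⟩) hVtop
    (isCompact_image_dualScale_walkTrace δ D) ((isPreconnected_walkTrace D).image _ hdc.continuousOn)
    (fun p hp ↦ by
      have h := symm_dualTrace_subset hδ hδρ hroom hxout hy hDS hp
      rw [mem_plateBox_iff_abs] at h
      exact abs_le.1 (h.2.trans hd))
    ⟨_, mem_image_of_mem _ (toComplex_mem_walkTrace_of_mem_support hDnil D.start_mem_support), by
      show (Φ.symm (dualDraw δ fD)).re ≤ -a; linarith⟩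
    ⟨_, mem_image_of_mem _ (toComplex_mem_walkTrace_of_mem_support hDnil D.end_mem_support), by
      show a ≤ (Φ.symm (dualDraw δ gD)).re; linarith⟩
  exact Set.disjoint_left.1 (hdisj D hDω) hptH hptV

/-! ### The blocking theorem -/

/-- **A vertical honeycomb loop arc, `η`-close to the `ℤ²` loops, blocks the monochromatic
horizontal `ℤ²` plate crossings.**  See the module docstring. [cite: CamiaNewman2006, §5] -/
theorem not_mem_zdMonoPlateH_of_closeArc :
    ∀ (Φ : ℂ ≃ₜ ℂ) (c : ℝ), 0 < c → ∃ η₀ : ℝ, 0 < η₀ ∧ ∀ η : ℝ, 0 < η → η ≤ η₀ →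
      ∃ δ₀ : ℝ, 0 < δ₀ ∧ ∀ δ : ℝ, 0 < δ → δ ≤ δ₀ →
      ∀ (x yin : ℝ), c ≤ x → x + c ≤ 2 → 2 * c ≤ yin → yin ≤ 2 →
      ∀ (ω : BondConfig (Site 2)) (ω' : SiteConfig (Site 2)), ω ⊆ (zdGraph 2).edgeSet →
        LoopConfig.IsClose η (bondLoopConfig δ 0 ω) (siteLoopConfig δ ω') →
        ∀ (f : HexVertex) (w : hexGraph.Walk f f), IsSiteInterfaceLoop ω' w →
          (siteLoopCurve δ w).range ⊆ ball (0 : ℂ) (1 / η) →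
          ∀ (β : Curve ℂ) (s t : I), CurveClass.mk β = siteLoopCurve δ w → s ≤ t →
            (∀ u ∈ Icc s t, β u ∈ Φ '' plateBox (x + c / 2) yin) →
            (∃ u ∈ Icc s t, β u ∈ Φ '' {z : ℂ | z.im ≤ -(yin - c / 2)}) →
            (∃ u ∈ Icc s t, β u ∈ Φ '' {z : ℂ | yin - c / 2 ≤ z.im}) →
            ∀ xout : ℝ, xout ≤ 2 → ω ∉ zdMonoPlateH Φ δ (x + c) xout (yin - c) := by
  intro Φ c hc
  have hν : 0 < c / 16 := by positivity
  obtain ⟨ρ, hρ, -, hroom⟩ := exists_chart_room_symm' Φ hν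
  refine ⟨ρ / 4, by positivity, fun η hη hηρ ↦ ⟨ρ / 8, by positivity, fun δ hδ hδρ ↦ ?_⟩⟩
  intro x yin hx hx2 hyin hyin2 ω ω' hωE hC f w hw hrange β s t hβ hst hband hbot htop xout hxout
  have hδρ' : δ ≤ ρ := by linarith
  ------------------------------------------------------------------
  -- Step 1: the partner medial loop of `ω`, and the stretch of darts `2η`-close to `β([s,t])`
  ------------------------------------------------------------------
  have hβloop : β.IsLoop := CurveClass.isLoop_mk.1 (hβ ▸ isLoop_siteLoopCurve δ w)
  set u' : UnbasedLoop ℂ :=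
    UnbasedLoop.mk (BasedLoop.mk (CurveClass.mk β) (CurveClass.isLoop_mk.2 hβloop)) with hu'def
  have hu'eq : u' = UnbasedLoop.mk (BasedLoop.mk (siteLoopCurve δ w) (isLoop_siteLoopCurve δ w)) := by
    rw [hu'def, BasedLoop.mk_congr hβ]
  set i : Fin 2 := if 0 < shoelace (w.support.map hexCenter) then 1 else 0 with hidef
  have hu' : u' ∈ (siteLoopConfig δ ω').F i := by
    rw [hu'eq]
    refine mem_siteLoopConfig_iff.2 ⟨f, w, hw, ?_, rfl⟩
    by_cases hs : 0 < shoelace (w.support.map hexCenter) <;> simp [hidef, hs]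
  have hu'range : u'.range ⊆ ball (0 : ℂ) (1 / η) := by rw [hu'eq]; exact hrange
  obtain ⟨u, hu, hud⟩ := (hC i).2 u' hu' hu'range
  obtain ⟨γ, hγ, -, rfl⟩ := mem_bondLoopConfig_iff.1 hu
  have hd : UnbasedLoop.udist u'
      (UnbasedLoop.mk (BasedLoop.mk (loopCurve δ 0 γ) (isLoop_loopCurve δ 0 hγ.ne_nil))) < 2 * η := by
    linarith
  obtain ⟨p, J₁, J₂, q, hJ, hclose, hin, hall⟩ := hγ.exists_dart_stretch_of_udist_lt δ hβloop hd hst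
  ------------------------------------------------------------------
  -- Step 2: chart room along the stretch (`4δ + 2η ≤ ρ`, `ν = c/16`)
  ------------------------------------------------------------------
  set ν := c / 16 with hνdef
  have near : ∀ v ∈ Icc s t, ∀ y' : ℂ, dist y' (q v) ≤ 4 * δ →
      |(Φ.symm y').re| ≤ x + c / 2 + ν ∧ |(Φ.symm y').im - (Φ.symm (β v)).im| ≤ ν := by
    intro v hv y' hy'
    have hz := symm_mem_of_mem_image (hband v hv)
    have hz2 : Φ.symm (β v) ∈ plateBox 2 2 := plateBox_subset_two (by linarith) hyin2 hz
    have hdist : dist y' (Φ (Φ.symm (β v))) ≤ ρ := by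
      rw [Homeomorph.apply_symm_apply]
      have h1 := hclose v
      rw [dist_comm] at h1
      linarith [dist_triangle y' (q v) (β v)]
    have hnear := chart_coords_near hroom hz2 hdist
    rw [mem_plateBox_iff_abs] at hz
    refine ⟨?_, hnear.2⟩
    have := abs_sub_abs_le_abs_sub (Φ.symm y').re (Φ.symm (β v)).re
    linarith [hnear.1, hz.1]
  obtain ⟨ub, hub, hubz⟩ := hbot
  obtain ⟨ut, hut, hutz⟩ := htop
  have hubim : (Φ.symm (β ub)).im ≤ -(yin - c / 2) := symm_mem_of_mem_image hubz
  have hutim : yin - c / 2 ≤ (Φ.symm (β ut)).im := symm_mem_of_mem_image hutz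
  obtain ⟨Jb, hJb1, hJb2, hqb⟩ := hin ub hub
  obtain ⟨Jt, hJt1, hJt2, hqt⟩ := hin ut hut
  ------------------------------------------------------------------
  -- Step 3: the open walk on the left and the dual-open walk on the right of the stretch
  ------------------------------------------------------------------
  obtain ⟨Wl, hWls, hWls', hWlω⟩ := exists_left_walk_iterate ω p hJ
  obtain ⟨Wr, hWrs, hWrs', hWrω⟩ := exists_cFace_walk_iterate ω p hJ
  -- distances: left vertex within `δ`, drawn right face within `3δ` of the dart segment
  have hdl : ∀ {J : ℕ} {v : I}, q v ∈ segment ℝ (medialPoint δ (cSrc ((nextCorner ω)^[J] p)))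
      (medialPoint δ (cTgt ((nextCorner ω)^[J] p))) →
      dist (meshPoint δ ((nextCorner ω)^[J] p).1) (q v) ≤ δ := fun hqv ↦ by
    rw [dist_comm]; exact dist_le_of_mem_dartSeg hδ.le _ hqv
  have hdr : ∀ {J : ℕ} {v : I}, q v ∈ segment ℝ (medialPoint δ (cSrc ((nextCorner ω)^[J] p)))
      (medialPoint δ (cTgt ((nextCorner ω)^[J] p))) →
      dist (dualDraw δ (cFace ((nextCorner ω)^[J] p))) (q v) ≤ 3 * δ := fun hqv ↦ by
    rw [dualDraw, dist_comm]; exact dist_dualScale_cFace_le_of_mem_dartSeg hδ.le _ hqv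
  -- the two walks pull back into the strip `|re| ≤ x + c/2 + ν`
  have hVl_strip : ∀ p' ∈ meshTrace δ Wl, |(Φ.symm p').re| ≤ x + c / 2 + ν := by
    intro p' hp'
    obtain ⟨x', hx', hdx⟩ := exists_dist_meshPoint_le_of_mem_meshTrace hp'
    rw [abs_of_pos hδ] at hdx
    obtain ⟨J, hJ1, hJ2, rfl⟩ := hWls x' hx'
    obtain ⟨v, hv, hqv⟩ := hall J hJ1 hJ2
    exact (near v hv p' (by
      linarith [dist_triangle p' (meshPoint δ ((nextCorner ω)^[J] p).1) (q v), hdl hqv])).1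
  have hVr_strip : ∀ p' ∈ dualScale δ '' walkTrace Wr, |(Φ.symm p').re| ≤ x + c / 2 + ν := by
    intro p' hp'
    obtain ⟨x', hx', hdx⟩ := exists_dist_dualScale_le_of_mem_image_walkTrace hδ.le hp'
    obtain ⟨J, hJ1, hJ2, rfl⟩ := hWrs x' hx'
    obtain ⟨v, hv, hqv⟩ := hall J hJ1 hJ2
    have h2 : dist p' (dualDraw δ (cFace ((nextCorner ω)^[J] p))) ≤ δ := hdx
    exact (near v hv p' (by
      linarith [dist_triangle p' (dualDraw δ (cFace ((nextCorner ω)^[J] p))) (q v), hdr hqv])).1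
  -- the end zones: the vertex / face of the darts carrying `β ub`, `β ut`
  have hlb : (Φ.symm (meshPoint δ ((nextCorner ω)^[Jb] p).1)).im ≤ -(yin - c / 2) + ν := by
    have := (near ub hub _ ((hdl hqb).trans (by linarith))).2; rw [abs_le] at this; linarith [this.2]
  have hlt : yin - c / 2 - ν ≤ (Φ.symm (meshPoint δ ((nextCorner ω)^[Jt] p).1)).im := by
    have := (near ut hut _ ((hdl hqt).trans (by linarith))).2; rw [abs_le] at this; linarith [this.1]
  have hrb : (Φ.symm (dualDraw δ (cFace ((nextCorner ω)^[Jb] p)))).im ≤ -(yin - c / 2) + ν := by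
    have := (near ub hub _ ((hdr hqb).trans (by linarith))).2; rw [abs_le] at this; linarith [this.2]
  have hrt : yin - c / 2 - ν ≤ (Φ.symm (dualDraw δ (cFace ((nextCorner ω)^[Jt] p)))).im := by
    have := (near ut hut _ ((hdr hqt).trans (by linarith))).2; rw [abs_le] at this; linarith [this.1]
  -- hence both walks are non-trivial
  have hWlnil : ¬ Wl.Nil := by
    intro hnil
    rw [SimpleGraph.Walk.nil_iff_support_eq] at hnil
    have h1 := hWls' Jb hJb1 hJb2
    have h2 := hWls' Jt hJt1 hJt2
    rw [hnil, List.mem_singleton] at h1 h2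
    rw [h1] at hlb; rw [h2] at hlt
    linarith
  have hWrnil : ¬ Wr.Nil := by
    intro hnil
    rw [SimpleGraph.Walk.nil_iff_support_eq] at hnil
    have h1 := hWrs' Jb hJb1 hJb2
    have h2 := hWrs' Jt hJt1 hJt2
    rw [hnil, List.mem_singleton] at h1 h2
    rw [h1] at hrb; rw [h2] at hrt
    linarith
  ------------------------------------------------------------------
  -- Step 4: blocking
  ------------------------------------------------------------------
  have hxin : 0 < x + c := by linarith
  have ha : 0 ≤ x + c / 2 + ν := by linarith
  have haxin : x + c / 2 + ν ≤ x + c := by linarith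
  have hdd : yin - c + ν ≤ yin - c / 2 - ν := by linarith
  have hd0 : 0 ≤ yin - c / 2 - ν := by linarith
  have hy2 : yin - c ≤ 2 := by linarith
  intro hmono
  simp only [zdMonoPlateH, Set.mem_union, Set.mem_preimage] at hmono
  rcases hmono with hP | hD
  · -- a primal horizontal crossing would meet the dual-open walk on the right of the stretch
    refine not_mem_zdPlateH_meshPoint_of_chart_vertical Φ hroom hδ hδρ' hxin ha haxin hdd hd0 hxout hy2
      (V := dualScale δ '' walkTrace Wr) (isCompact_image_dualScale_walkTrace δ Wr)
      ((isPreconnected_walkTrace Wr).image _ (continuous_dualScale δ).continuousOn) hVr_strip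
      ⟨_, mem_image_of_mem _ (toComplex_mem_walkTrace_of_mem_support hWrnil (hWrs' Jb hJb1 hJb2)), by
        show (Φ.symm (dualDraw δ (cFace ((nextCorner ω)^[Jb] p)))).im ≤ _; linarith⟩
      ⟨_, mem_image_of_mem _ (toComplex_mem_walkTrace_of_mem_support hWrnil (hWrs' Jt hJt1 hJt2)), by
        show _ ≤ (Φ.symm (dualDraw δ (cFace ((nextCorner ω)^[Jt] p)))).im; linarith⟩
      hωE (fun P hPω ↦ disjoint_meshTrace_image_dualScale_walkTrace hδ.ne' hPω hWrω) hP
  · -- a dual horizontal crossing would meet the open walk on the left of the stretch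
    refine not_mem_zdPlateH_dualDraw_of_chart_vertical Φ hroom hδ hδρ' hxin ha haxin hdd hd0 hxout hy2
      (V := meshTrace δ Wl) (isCompact_meshTrace δ Wl) (isPreconnected_meshTrace δ Wl) hVl_strip
      ⟨_, meshPoint_mem_meshTrace_of_mem_support hWlnil (hWls' Jb hJb1 hJb2), by linarith⟩
      ⟨_, meshPoint_mem_meshTrace_of_mem_support hWlnil (hWls' Jt hJt1 hJt2), by linarith⟩
      (fun D hDω ↦ (disjoint_meshTrace_image_dualScale_walkTrace hδ.ne' hWlω hDω).symm) hD

end Literature.Probability.Percolation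

end
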